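import Summits.QuantumFields.YangMills.Theorems.BalabanUVNodesN15KingModelJetLettersColour
import Summits.QuantumFields.YangMills.Theorems.BalabanUVNodesN15BackgroundCoefficientTaylor
import HarnessLib

/-!
# BalabanUVNodes ∕ N15 — THE KING-MODEL RUNG, PROGRAMME Y (the dressed SOURCE-DIVERGENCE entry of the King jet), FILE 69:
# THE BY-PARTS FIXED POINT OF THE DRESSED THIRD ENTRY — `X∘T = G∘T + [G∘M_{c − Σ_μ b_μ} + Σ_μ (G∘N∇_μ)∘M_{a_μ(·−e_μ)}]∘(X∘T)` — and the letters it produces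
# (algebra only; both grids)

WHO ∕ WHEN.  Cell `pub-ymgap`, seat `pub-ymgap-dag-n15-d` (R134, N15 NE2 s3 = King-model rung, g22); `--kind proof --supports stmt-QuantumFields-27366 --as helper`
(K3⁸; count-neutral).  THEOREMS ONLY (0 `def`).  Over dag-n15-b's pair space (`bgPair`, `projO_none_bgPair`, `projO_some_bgPair_of_comp`, `unstack_apply`), dag-n15-a's
symbols (`symbOp`, `sD`, `sT`, `sTinv`, `symbOp_sD_apply`, `symbOp_sT_pow_apply`, `sTinv_pow`), dag-n15-c FILE 10 `…BackgroundCoefficientTaylor` (`abs_sub_symm_le_of_fgrad`,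
`blockAvg_translate`, `blockAvg_sub`, `blockAvg_mul`, `kingPrV_bshiftEquiv_pow`, `norm_powSymm_sub_le`), `kingPr_add_smul_unitVec_of_le`, `add_unitVec_ne` BY NAME; nothing
in the tree is modified.

WHY (this seat's ARCHITECTURE NOTE «ENTRY 2 LIVE BY PARTS», pub-ymgap INBOX l.43300).  The dressed third entry `Y_κ = X∘N∇*_κ` of the first-order King jet
(`X = projO none ∘ bgPair G (N∇_μ∘G)_μ c a`, species `V = M_c + Σ_μ M_{a_μ}N∇_μ`) satisfies, after ONE lattice Leibniz step `M_a∘N∇_μ = N∇_μ∘M_{a(·−e_μ)} − M_{b}`,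
`b = N(a − a(·−e_μ))`, the fixed-point equation of the title: no derivative meets `X∘T`, the rough letter `c` only meets `G` on its left, and the derivative letter
`b` is the THIRD (3.35) letter (`|N∇a| ≤ r`).  The coarse run obeys the same identity with the block-averaged letters `c̄, ā`; its derived letters are NOT the block
averages of the fine ones — the file computes the mismatch exactly: `b̄_μ = blockAvg(B′_μ)` with `B′_μ = N̄(a′ − a′(·−L^n e′_μ))` (the COARSE-STEP quotient on the fine
grid, block-translation law), `b′_μ − B′_μ = (L^n)⁻¹Σ_{j<L^n}(b′_μ − b′_μ(·−je′_μ))` (telescoping), and `ā(·−ē_μ) = blockAvg(a′(·−L^n e′_μ))`; FILE 70 turns the first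
into a sum of fine shift commutators (small behind `G′`: `G′∘(1 − s^{−j}) = −N′⁻¹Σ_{i<j}(G′N′∇′*)∘s^{−i}`) plus one coarse difference quotient of the test function
(`s′^{j}∘P − P = M_θ∘P∘N̄∇̄_μ`, `0 ≤ θ ≤ N̄⁻¹`, King's pairing moves by at most one coarse step).

WHAT.  §1 `mulOp_comp_symbOp_sD` (Leibniz), `tensorId_kingGOp_comp_symbOp_sD` (dictionary `(A₀⁻¹⊗1)∘ρ(N(s_μ−1)) = (A₀⁻¹∘N(τ_{e_μ}−1)) ⊗ 1` = FILE 66∕67's `S̃_μ`),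
`unstack_comp_eq`; §2 ★★ `srcDiv_byParts_fix` (`X = G + 𝕄∘X`), ★★ `srcDiv_byParts_comp` (`X∘T = G∘T + 𝕄∘(X∘T)`); §3 letters: `abs_bLetter_le` (`|b| ≤ r`),
`abs_wLetter_le` (`|c − Σb| ≤ (d+2)r`), `abs_coarseStepQuot_le` (`|B′| ≤ r`), `blockAvg_shift_pow` (`ā(·−ē) = blockAvg(a′(·−L^n e′))`), ★ `bbar_eq_blockAvg_coarseStepQuot`
(`b̄ = blockAvg B′`), ★ `bLetter_sub_coarseStepQuot` (the telescoping), `abs_shiftFit_le` (`|a′(·−L^n e′) − a′(·−e′)| ≤ r∕L^K`); §4 shift algebra for FILE 70: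
`mulOp_shift_eq_conj`, `symbOp_one_sub_sTinv_pow`, ★ `sT_pow_comp_pull_eq` (`ρ′(s_μ^j)∘P = P + M_θ∘P∘ρ̄(N̄(s_μ−1))`, `0 ≤ θ ≤ N̄⁻¹`, `j ≤ L^n`).

HONEST FRAMING ∕ LIMITS.  Finite-lattice algebra on King's torus carriers (template literature [King1986] (4.1)–(4.5) p.670 for `A₀`; [Balaban1985BackgroundPropagators] (3.52)
p.400, (3.64)–(3.65) pp.402–403 for the species and the jet: SHAPES only); no estimate of [B6]∕[B9] used or asserted; NE2⁺ NOT PRINTED ∕ NOT proved; no statement of record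
touched; N15 NOT discharged; K3⁸ OPEN; counts UNMOVED (typed 28∕28 · discharged 5∕27); one finite torus per index — NOT ℝ⁴ ∕ infinite volume ∕ OS ∕ mass gap ∕ Clay.
-/

noncomputable section

open scoped BigOperators Matrix
open Finset

namespace Summit.QuantumFields.YangMills.BalabanUVNodes.N15.KingModel.SrcDiv

open Literature.MathematicalPhysics.QuantumFieldTheory.Balaban1983to89
open Literature.MathematicalPhysics.QuantumFieldTheory.Balaban1983to89.T4EtaRateCoeffDefect (pull pull_apply blockAvg fibre mem_fibre FibreOsc fit_blockAvg)
open Literature.MathematicalPhysics.QuantumFieldTheory.Balaban1983to89.B6Prop26Gluing (mulOp mulOp_apply)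
open Literature.MathematicalPhysics.QuantumFieldTheory.Balaban1983to89.B5Prop11Plancherel (Tor fine unitVec)
open Summit.QuantumFields.YangMills.BalabanUVNodes.N15.VectorPiece (kingPr kingPrV kingPrV_eq tensorId tensorId_apply bshiftEquiv bshiftEquiv_apply bshiftEquiv_symm_apply
  bshiftEquiv_pow_apply kingPrV_bshiftEquiv_pow)
open Summit.QuantumFields.YangMills.BalabanUVNodes.N15.TwoGrid (symbOp sD sT sTinv symbOp_sD_apply symbOp_sT_pow_apply symbOp_sTinv_apply sTinv_pow symbOp_single_apply
  kingPr_add_smul_unitVec_of_le)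
open Summit.QuantumFields.YangMills.BalabanUVNodes.N15.BackgroundLayer (stack unstack unstack_apply projO projO_apply bgPair projO_none_bgPair projO_some_bgPair_of_comp fgrad
  fgrad_apply abs_sub_symm_le_of_fgrad blockAvg_translate blockAvg_sub blockAvg_mul norm_powSymm_sub_le)
open Summit.QuantumFields.YangMills.BalabanUVNodes.N15KingModelRung.Curved (kingGOp kingGOp_apply add_unitVec_ne)

variable {d : ℕ} (L : ℕ)

/-! ## §1 Lattice Leibniz on the coloured carrier; the dictionary `(A₀⁻¹⊗1)∘ρ(N(s_μ−1))` -/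

section Leibniz

variable (N : ℕ) [NeZero N] (M : Fin (d + 1) → ℕ) [∀ μ, NeZero (M μ)]

omit L [NeZero N] [∀ μ, NeZero (M μ)] in
/-- **LATTICE LEIBNIZ**: `M_a∘N∇_μ = N∇_μ∘M_{a(·−e_μ)} − M_{b}`, `b = N(a − a(·−e_μ))` — on the coloured fine carrier, `N∇_μ = ρ(N(s_μ − 1))`. [folklore] -/
theorem mulOp_comp_symbOp_sD (a : Tor (fine N M) × Fin (d + 1) → ℝ) (μ : Fin (d + 1)) :
    mulOp a ∘ₗ symbOp M N (sD M N μ ((N : ℕ) : ℝ))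
      = symbOp M N (sD M N μ ((N : ℕ) : ℝ)) ∘ₗ mulOp (fun p : Tor (fine N M) × Fin (d + 1) => a (p.1 - unitVec (fine N M) μ, p.2))
        - mulOp (fun p : Tor (fine N M) × Fin (d + 1) => ((N : ℕ) : ℝ) * (a p - a (p.1 - unitVec (fine N M) μ, p.2))) := by
  refine LinearMap.ext fun f => funext fun p => ?_
  simp only [LinearMap.comp_apply, LinearMap.sub_apply, Pi.sub_apply, mulOp_apply, symbOp_sD_apply, add_sub_cancel_right]
  ring

/-- DICTIONARY: `(A₀⁻¹ ⊗ 1)∘ρ(N(s_μ − 1)) = (A₀⁻¹∘N(τ_{e_μ} − 1)) ⊗ 1` — the FORWARD source difference `S̃_μ` of FILEs 66∕67. [folklore] -/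
theorem tensorId_kingGOp_comp_symbOp_sD (a msq : ℝ) (Kl : ℕ) (μ : Fin (d + 1)) :
    tensorId (Fin (d + 1)) (kingGOp L a msq Kl N M) ∘ₗ symbOp M N (sD M N μ ((N : ℕ) : ℝ))
      = tensorId (Fin (d + 1)) (kingGOp L a msq Kl N M ∘ₗ (((N : ℕ) : ℝ) • (pull (fun y : Tor (fine N M) => y + unitVec (fine N M) μ) - LinearMap.id))) := by
  refine LinearMap.ext fun f => funext fun p => ?_
  have hfun : (fun x : Tor (fine N M) => symbOp M N (sD M N μ ((N : ℕ) : ℝ)) f (x, p.2))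
      = ((((N : ℕ) : ℝ) • (pull (fun y : Tor (fine N M) => y + unitVec (fine N M) μ) - LinearMap.id) :
          (Tor (fine N M) → ℝ) →ₗ[ℝ] (Tor (fine N M) → ℝ))) (fun x => f (x, p.2)) := by
    funext y
    rw [symbOp_sD_apply, LinearMap.smul_apply, LinearMap.sub_apply, Pi.smul_apply, Pi.sub_apply, pull_apply, LinearMap.id_apply, smul_eq_mul]
  rw [LinearMap.comp_apply, tensorId_apply, tensorId_apply, LinearMap.comp_apply, hfun]

omit L [NeZero N] [∀ μ, NeZero (M μ)] in
/-- The unstacked perturbation composed: `V̂∘X̂ = M_c∘(X̂)_none + Σ_μ M_{a_μ}∘(X̂)_μ`. [cite: Balaban1985BackgroundPropagators, (3.52) p.400 (first-order species, shape)] -/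
theorem unstack_comp_eq {F : Type} [AddCommGroup F] [Module ℝ F] (c : Tor (fine N M) × Fin (d + 1) → ℝ) (a : Fin (d + 1) → Tor (fine N M) × Fin (d + 1) → ℝ)
    (Xh : F →ₗ[ℝ] ((Tor (fine N M) × Fin (d + 1)) × Option (Fin (d + 1)) → ℝ)) :
    unstack c a ∘ₗ Xh = mulOp c ∘ₗ (projO none ∘ₗ Xh) + ∑ μ, mulOp (a μ) ∘ₗ (projO (some μ) ∘ₗ Xh) := by
  refine LinearMap.ext fun f => funext fun p => ?_
  simp only [LinearMap.comp_apply, unstack_apply, LinearMap.add_apply, LinearMap.sum_apply, Finset.sum_apply, Pi.add_apply, mulOp_apply, projO_apply]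

end Leibniz

/-! ## §2 ★★ The by-parts fixed point -/

section ByParts

variable {L} (N : ℕ) [NeZero N] (M : Fin (d + 1) → ℕ) [∀ μ, NeZero (M μ)]

omit L in
/-- ★★ **THE BY-PARTS FIXED POINT** (generic piece `G` on the coloured carrier of spacing `N⁻¹`): for the (3.65) jet `X̂ = bgPair G (N∇_μ∘G)_μ c a` (fixed point
available) and `X = (X̂)_none`,
`X = G + [G∘M_{c − Σ_μ b_μ} + Σ_μ (G∘N∇_μ)∘M_{a_μ(·−e_μ)}]∘X`, `b_μ = N(a_μ − a_μ(·−e_μ))` — `X = G + G(M_cX + Σ M_{a_μ}N∇_μX)` with Leibniz applied to the last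
term. [cite: Balaban1985BackgroundPropagators, (3.52) p.400, (3.64)–(3.65) pp.402–403 (shapes, mechanism)] -/
theorem srcDiv_byParts_fix {G : (Tor (fine N M) × Fin (d + 1) → ℝ) →ₗ[ℝ] (Tor (fine N M) × Fin (d + 1) → ℝ)}
    {c : Tor (fine N M) × Fin (d + 1) → ℝ} {a : Fin (d + 1) → Tor (fine N M) × Fin (d + 1) → ℝ}
    (hunit : IsUnit (1 - LinearMap.toMatrix' (stack G (fun μ => symbOp M N (sD M N μ ((N : ℕ) : ℝ)) ∘ₗ G) ∘ₗ unstack c a))) :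
    projO none ∘ₗ bgPair G (fun μ => symbOp M N (sD M N μ ((N : ℕ) : ℝ)) ∘ₗ G) c a
      = G + (G ∘ₗ mulOp (fun p : Tor (fine N M) × Fin (d + 1) => c p - ∑ μ, ((N : ℕ) : ℝ) * (a μ p - a μ (p.1 - unitVec (fine N M) μ, p.2)))
          + ∑ μ, (G ∘ₗ symbOp M N (sD M N μ ((N : ℕ) : ℝ))) ∘ₗ mulOp (fun p : Tor (fine N M) × Fin (d + 1) => a μ (p.1 - unitVec (fine N M) μ, p.2))) ∘ₗ
        (projO none ∘ₗ bgPair G (fun μ => symbOp M N (sD M N μ ((N : ℕ) : ℝ)) ∘ₗ G) c a) := by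
  have hX := projO_none_bgPair (G := G) (D := fun μ => symbOp M N (sD M N μ ((N : ℕ) : ℝ)) ∘ₗ G) (c := c) (a := a) hunit
  have hXμ : ∀ μ, projO (some μ) ∘ₗ bgPair G (fun μ => symbOp M N (sD M N μ ((N : ℕ) : ℝ)) ∘ₗ G) c a
      = symbOp M N (sD M N μ ((N : ℕ) : ℝ)) ∘ₗ (projO none ∘ₗ bgPair G (fun μ => symbOp M N (sD M N μ ((N : ℕ) : ℝ)) ∘ₗ G) c a) :=
    fun μ => projO_some_bgPair_of_comp hunit rfl
  -- name the dressed value operator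
  obtain ⟨X, hXdef⟩ : ∃ X : (Tor (fine N M) × Fin (d + 1) → ℝ) →ₗ[ℝ] (Tor (fine N M) × Fin (d + 1) → ℝ),
      X = projO none ∘ₗ bgPair G (fun μ => symbOp M N (sD M N μ ((N : ℕ) : ℝ)) ∘ₗ G) c a := ⟨_, rfl⟩
  rw [← hXdef] at hX hXμ ⊢
  -- `V̂∘X̂ = M_w X + Σ N∇_μ(M_{ã_μ} X)` (pointwise, Leibniz folded in)
  have hV : ∀ f, unstack c a (bgPair G (fun μ => symbOp M N (sD M N μ ((N : ℕ) : ℝ)) ∘ₗ G) c a f)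
      = mulOp (fun p : Tor (fine N M) × Fin (d + 1) => c p - ∑ μ, ((N : ℕ) : ℝ) * (a μ p - a μ (p.1 - unitVec (fine N M) μ, p.2))) (X f)
        + ∑ μ, symbOp M N (sD M N μ ((N : ℕ) : ℝ)) (mulOp (fun p : Tor (fine N M) × Fin (d + 1) => a μ (p.1 - unitVec (fine N M) μ, p.2)) (X f)) := by
    intro f
    have hμf : ∀ μ p, bgPair G (fun μ => symbOp M N (sD M N μ ((N : ℕ) : ℝ)) ∘ₗ G) c a f (p, some μ) = symbOp M N (sD M N μ ((N : ℕ) : ℝ)) (X f) p := by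
      intro μ p
      have h := LinearMap.congr_fun (hXμ μ) f
      have h2 := congr_fun h p
      simpa only [LinearMap.comp_apply, projO_apply] using h2
    have h0f : ∀ p, bgPair G (fun μ => symbOp M N (sD M N μ ((N : ℕ) : ℝ)) ∘ₗ G) c a f (p, none) = X f p := by
      intro p
      rw [hXdef, LinearMap.comp_apply, projO_apply]
    funext p
    simp only [unstack_apply, h0f, hμf, Pi.add_apply, Finset.sum_apply, mulOp_apply, symbOp_sD_apply, add_sub_cancel_right, Prod.mk.eta]
    have key : ∀ μ ∈ (Finset.univ : Finset (Fin (d + 1))), a μ p * (((N : ℕ) : ℝ) * (X f (p.1 + unitVec (fine N M) μ, p.2) - X f p))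
        = -(((N : ℕ) : ℝ) * (a μ p - a μ (p.1 - unitVec (fine N M) μ, p.2)) * X f p)
          + ((N : ℕ) : ℝ) * (a μ p * X f (p.1 + unitVec (fine N M) μ, p.2) - a μ (p.1 - unitVec (fine N M) μ, p.2) * X f p) := fun μ _ => by ring
    rw [Finset.sum_congr rfl key, Finset.sum_add_distrib, Finset.sum_neg_distrib, sub_mul, Finset.sum_mul]
    ring
  -- assemble at the operator level
  refine LinearMap.ext fun f => ?_
  have h1 := LinearMap.congr_fun hX f
  rw [LinearMap.add_apply, LinearMap.comp_apply, LinearMap.comp_apply, hV, map_add, map_sum] at h1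
  rw [h1]
  simp only [LinearMap.add_apply, LinearMap.comp_apply, LinearMap.sum_apply]

omit L in
/-- ★★ … composed with any source-side operator `T` (e.g. `T = N∇*_κ`: the dressed third entry `Y_κ = X∘N∇*_κ`): `X∘T = G∘T + 𝕄∘(X∘T)`.
[cite: Balaban1985BackgroundPropagators, (3.42) p.397 (third entry, shape), (3.65) p.403] -/
theorem srcDiv_byParts_comp {G : (Tor (fine N M) × Fin (d + 1) → ℝ) →ₗ[ℝ] (Tor (fine N M) × Fin (d + 1) → ℝ)}
    {c : Tor (fine N M) × Fin (d + 1) → ℝ} {a : Fin (d + 1) → Tor (fine N M) × Fin (d + 1) → ℝ}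
    (hunit : IsUnit (1 - LinearMap.toMatrix' (stack G (fun μ => symbOp M N (sD M N μ ((N : ℕ) : ℝ)) ∘ₗ G) ∘ₗ unstack c a)))
    (T : (Tor (fine N M) × Fin (d + 1) → ℝ) →ₗ[ℝ] (Tor (fine N M) × Fin (d + 1) → ℝ)) :
    (projO none ∘ₗ bgPair G (fun μ => symbOp M N (sD M N μ ((N : ℕ) : ℝ)) ∘ₗ G) c a) ∘ₗ T
      = G ∘ₗ T + (G ∘ₗ mulOp (fun p : Tor (fine N M) × Fin (d + 1) => c p - ∑ μ, ((N : ℕ) : ℝ) * (a μ p - a μ (p.1 - unitVec (fine N M) μ, p.2)))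
          + ∑ μ, (G ∘ₗ symbOp M N (sD M N μ ((N : ℕ) : ℝ))) ∘ₗ mulOp (fun p : Tor (fine N M) × Fin (d + 1) => a μ (p.1 - unitVec (fine N M) μ, p.2))) ∘ₗ
        ((projO none ∘ₗ bgPair G (fun μ => symbOp M N (sD M N μ ((N : ℕ) : ℝ)) ∘ₗ G) c a) ∘ₗ T) := by
  conv_lhs => rw [srcDiv_byParts_fix N M hunit]
  rw [LinearMap.add_comp, LinearMap.comp_assoc]

end ByParts

/-! ## §3 The letters of the by-parts fixed point and the coarse letter mismatch -/

section Letters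

variable {L} (N : ℕ) [NeZero N] (M : Fin (d + 1) → ℕ) [∀ μ, NeZero (M μ)]

omit L [∀ μ, NeZero (M μ)] in
/-- `|b_μ| ≤ r`: the derived letter `b_μ = N(a_μ − a_μ(·−e_μ))` is bounded by the THIRD (3.35) letter `|N∇_μ a_μ| ≤ r`. [cite: Balaban1985BackgroundPropagators, (3.35) p.396 (shape)] -/
theorem abs_bLetter_le {a : Tor (fine N M) × Fin (d + 1) → ℝ} {r : ℝ} (μ : Fin (d + 1))
    (h : ∀ z, |fgrad ((N : ℕ) : ℝ) (bshiftEquiv M N μ) a z| ≤ r) (p : Tor (fine N M) × Fin (d + 1)) :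
    |((N : ℕ) : ℝ) * (a p - a (p.1 - unitVec (fine N M) μ, p.2))| ≤ r := by
  have hN : (0 : ℝ) < ((N : ℕ) : ℝ) := by exact_mod_cast Nat.pos_of_ne_zero (NeZero.ne N)
  have h1 := abs_sub_symm_le_of_fgrad hN (bshiftEquiv M N μ) h p
  rw [bshiftEquiv_symm_apply] at h1
  rw [abs_mul, abs_of_pos hN, ← abs_neg, neg_sub]
  calc ((N : ℕ) : ℝ) * |a (p.1 - unitVec (fine N M) μ, p.2) - a p| ≤ ((N : ℕ) : ℝ) * (r / ((N : ℕ) : ℝ)) :=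
        mul_le_mul_of_nonneg_left h1 hN.le
    _ = r := mul_div_cancel₀ r hN.ne'

omit L [∀ μ, NeZero (M μ)] in
/-- `|c − Σ_μ b_μ| ≤ (d+2)r`. [folklore] -/
theorem abs_wLetter_le {c : Tor (fine N M) × Fin (d + 1) → ℝ} {a : Fin (d + 1) → Tor (fine N M) × Fin (d + 1) → ℝ} {r : ℝ} (hc : ∀ z, |c z| ≤ r)
    (ha : ∀ μ κ z, |fgrad ((N : ℕ) : ℝ) (bshiftEquiv M N κ) (a μ) z| ≤ r) (p : Tor (fine N M) × Fin (d + 1)) :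
    |c p - ∑ μ, ((N : ℕ) : ℝ) * (a μ p - a μ (p.1 - unitVec (fine N M) μ, p.2))| ≤ ((d : ℝ) + 2) * r := by
  have h1 : |∑ μ, ((N : ℕ) : ℝ) * (a μ p - a μ (p.1 - unitVec (fine N M) μ, p.2))| ≤ ((d : ℝ) + 1) * r :=
    calc |∑ μ, ((N : ℕ) : ℝ) * (a μ p - a μ (p.1 - unitVec (fine N M) μ, p.2))|
        ≤ ∑ μ : Fin (d + 1), |((N : ℕ) : ℝ) * (a μ p - a μ (p.1 - unitVec (fine N M) μ, p.2))| := Finset.abs_sum_le_sum_abs _ _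
      _ ≤ ∑ _μ : Fin (d + 1), r := Finset.sum_le_sum fun μ _ => abs_bLetter_le N M μ (ha μ μ) p
      _ = ((d : ℝ) + 1) * r := by rw [Finset.sum_const, Finset.card_univ, Fintype.card_fin, nsmul_eq_mul]; push_cast; ring
  calc |c p - ∑ μ, ((N : ℕ) : ℝ) * (a μ p - a μ (p.1 - unitVec (fine N M) μ, p.2))|
      ≤ |c p| + |∑ μ, ((N : ℕ) : ℝ) * (a μ p - a μ (p.1 - unitVec (fine N M) μ, p.2))| := abs_sub _ _
    _ ≤ r + ((d : ℝ) + 1) * r := add_le_add (hc p) h1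
    _ = ((d : ℝ) + 2) * r := by ring

omit L [NeZero N] [∀ μ, NeZero (M μ)] in
/-- The `ℓ`-step backward orbit: `((τ_μ)^ℓ)⁻¹(x, i) = (x − ℓe_μ, i)`. [folklore] -/
theorem bshiftEquiv_pow_symm_apply (μ : Fin (d + 1)) (ℓ : ℕ) (p : Tor (fine N M) × Fin (d + 1)) :
    (bshiftEquiv M N μ ^ ℓ).symm p = (p.1 - ℓ • unitVec (fine N M) μ, p.2) := by
  rw [Equiv.symm_apply_eq, bshiftEquiv_pow_apply]
  simp

omit L [∀ μ, NeZero (M μ)] in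
/-- `|a(x) − a(x − ℓe_μ)| ≤ ℓ·r∕N` along `ℓ` steps of the `μ`-orbit. [folklore] -/
theorem abs_sub_shift_pow_le {a : Tor (fine N M) × Fin (d + 1) → ℝ} {r : ℝ} (μ : Fin (d + 1))
    (h : ∀ z, |fgrad ((N : ℕ) : ℝ) (bshiftEquiv M N μ) a z| ≤ r) (ℓ : ℕ) (p : Tor (fine N M) × Fin (d + 1)) :
    |a (p.1 - ℓ • unitVec (fine N M) μ, p.2) - a p| ≤ ℓ * (r / ((N : ℕ) : ℝ)) := by
  have hN : (0 : ℝ) < ((N : ℕ) : ℝ) := by exact_mod_cast Nat.pos_of_ne_zero (NeZero.ne N)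
  have hstep : ∀ z, ‖a ((bshiftEquiv M N μ).symm z) - a z‖ ≤ r / ((N : ℕ) : ℝ) := fun z => by
    rw [Real.norm_eq_abs]; exact abs_sub_symm_le_of_fgrad hN _ h z
  have h1 := norm_powSymm_sub_le (bshiftEquiv M N μ) hstep ℓ p
  rwa [Real.norm_eq_abs, bshiftEquiv_pow_symm_apply] at h1

variable (L) [NeZero L] (K n : ℕ)

omit [∀ μ, NeZero (M μ)] in
/-- `|B′_μ| ≤ r` for the COARSE-STEP quotient on the fine grid `B′_μ = N̄(a′ − a′(·−L^n e′_μ))` (`N̄ = L^K`, `N′ = L^nL^K`). [folklore] -/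
theorem abs_coarseStepQuot_le {a : Tor (fine (L ^ n * L ^ K) M) × Fin (d + 1) → ℝ} {r : ℝ} (μ : Fin (d + 1))
    (h : ∀ z, |fgrad ((L ^ n * L ^ K : ℕ) : ℝ) (bshiftEquiv M (L ^ n * L ^ K) μ) a z| ≤ r) (p : Tor (fine (L ^ n * L ^ K) M) × Fin (d + 1)) :
    |((L ^ K : ℕ) : ℝ) * (a p - a (p.1 - L ^ n • unitVec (fine (L ^ n * L ^ K) M) μ, p.2))| ≤ r := by
  have hL0 : 0 < L := Nat.pos_of_ne_zero (NeZero.ne L)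
  have hK0 : (0 : ℝ) < ((L ^ K : ℕ) : ℝ) := by exact_mod_cast pow_pos hL0 K
  have hN' : ((L ^ n * L ^ K : ℕ) : ℝ) = ((L ^ n : ℕ) : ℝ) * ((L ^ K : ℕ) : ℝ) := by push_cast; ring
  have h1 := abs_sub_shift_pow_le (L ^ n * L ^ K) M μ h (L ^ n) p
  rw [abs_mul, abs_of_pos hK0, ← abs_neg, neg_sub]
  calc ((L ^ K : ℕ) : ℝ) * |a (p.1 - L ^ n • unitVec (fine (L ^ n * L ^ K) M) μ, p.2) - a p|
      ≤ ((L ^ K : ℕ) : ℝ) * ((L ^ n : ℕ) * (r / ((L ^ n * L ^ K : ℕ) : ℝ))) := mul_le_mul_of_nonneg_left (by exact_mod_cast h1) hK0.le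
    _ = r := by rw [hN']; field_simp

/-- **BLOCK-TRANSLATION**: `ā(y − ē_μ) = blockAvg(a′(· − L^n e′_μ))(y)` — King's pairing carries `L^n` fine steps to one coarse step (dag-n15-a `kingPrV_bshiftEquiv_pow`,
dag-n15-c `blockAvg_translate`). [cite: King1986, p.664 (pairing convention)] -/
theorem blockAvg_shift_pow (a : Tor (fine (L ^ n * L ^ K) M) × Fin (d + 1) → ℝ) (μ : Fin (d + 1)) (q : Tor (fine (L ^ K) M) × Fin (d + 1)) :
    blockAvg (kingPrV L K n M) a (q.1 - unitVec (fine (L ^ K) M) μ, q.2)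
      = blockAvg (kingPrV L K n M) (fun p => a (p.1 - L ^ n • unitVec (fine (L ^ n * L ^ K) M) μ, p.2)) q := by
  have h := blockAvg_translate (kingPrV L K n M) (bshiftEquiv M (L ^ n * L ^ K) μ ^ L ^ n) (bshiftEquiv M (L ^ K) μ)
    (fun p => kingPrV_bshiftEquiv_pow L K n M μ p) a q
  rw [bshiftEquiv_symm_apply] at h
  rw [h]
  congr 1
  funext p
  rw [bshiftEquiv_pow_symm_apply]

/-- ★ **THE COARSE DERIVED LETTER IS THE BLOCK MEAN OF THE COARSE-STEP QUOTIENT**: `b̄_μ = N̄(ā − ā(·−ē_μ)) = blockAvg(B′_μ)`, `B′_μ = N̄(a′ − a′(·−L^n e′_μ))`.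
[cite: King1986, p.664 (pairing convention)] -/
theorem bbar_eq_blockAvg_coarseStepQuot (a : Tor (fine (L ^ n * L ^ K) M) × Fin (d + 1) → ℝ) (μ : Fin (d + 1)) (q : Tor (fine (L ^ K) M) × Fin (d + 1)) :
    ((L ^ K : ℕ) : ℝ) * (blockAvg (kingPrV L K n M) a q - blockAvg (kingPrV L K n M) a (q.1 - unitVec (fine (L ^ K) M) μ, q.2))
      = blockAvg (kingPrV L K n M) (fun p => ((L ^ K : ℕ) : ℝ) * (a p - a (p.1 - L ^ n • unitVec (fine (L ^ n * L ^ K) M) μ, p.2))) q := by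
  rw [blockAvg_shift_pow, blockAvg_mul, blockAvg_sub]

omit [NeZero L] [∀ μ, NeZero (M μ)] in
/-- ★ **THE LETTER MISMATCH, TELESCOPED**: `b′_μ − B′_μ = (L^n)⁻¹·Σ_{j<L^n}(b′_μ − b′_μ(·−je′_μ))` — the fine one-step quotient minus the coarse-step quotient is an average
of fine SHIFT COMMUTATORS of `b′_μ`. [folklore] -/
theorem bLetter_sub_coarseStepQuot (hL : 0 < L) (a : Tor (fine (L ^ n * L ^ K) M) × Fin (d + 1) → ℝ) (μ : Fin (d + 1)) (p : Tor (fine (L ^ n * L ^ K) M) × Fin (d + 1)) :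
    ((L ^ n * L ^ K : ℕ) : ℝ) * (a p - a (p.1 - unitVec (fine (L ^ n * L ^ K) M) μ, p.2))
        - ((L ^ K : ℕ) : ℝ) * (a p - a (p.1 - L ^ n • unitVec (fine (L ^ n * L ^ K) M) μ, p.2))
      = (((L ^ n : ℕ) : ℝ))⁻¹ * ∑ j ∈ Finset.range (L ^ n),
          (((L ^ n * L ^ K : ℕ) : ℝ) * (a p - a (p.1 - unitVec (fine (L ^ n * L ^ K) M) μ, p.2))
            - ((L ^ n * L ^ K : ℕ) : ℝ) * (a (p.1 - j • unitVec (fine (L ^ n * L ^ K) M) μ, p.2)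
                - a (p.1 - j • unitVec (fine (L ^ n * L ^ K) M) μ - unitVec (fine (L ^ n * L ^ K) M) μ, p.2))) := by
  have hℓ : ((L ^ n : ℕ) : ℝ) ≠ 0 := by exact_mod_cast pow_ne_zero n hL.ne'
  -- telescoping along the orbit
  have htel : ∑ j ∈ Finset.range (L ^ n), (a (p.1 - j • unitVec (fine (L ^ n * L ^ K) M) μ, p.2)
      - a (p.1 - j • unitVec (fine (L ^ n * L ^ K) M) μ - unitVec (fine (L ^ n * L ^ K) M) μ, p.2))
        = a p - a (p.1 - L ^ n • unitVec (fine (L ^ n * L ^ K) M) μ, p.2) := by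
    have h := Finset.sum_range_sub' (fun j : ℕ => a (p.1 - j • unitVec (fine (L ^ n * L ^ K) M) μ, p.2)) (L ^ n)
    simp only [zero_smul, sub_zero] at h
    rw [← h]
    refine Finset.sum_congr rfl fun j _ => ?_
    rw [succ_nsmul, sub_add_eq_sub_sub]
  rw [Finset.sum_sub_distrib, Finset.sum_const, Finset.card_range, nsmul_eq_mul, ← Finset.mul_sum, htel]
  push_cast
  field_simp
  ring

omit [∀ μ, NeZero (M μ)] in
/-- `|a′(·−L^n e′_μ) − a′(·−e′_μ)| ≤ r∕L^K`: the shifted fine letter `ã′_μ = a′(·−e′_μ)` against the pre-image `a′(·−L^n e′_μ)` of the shifted coarse letter `ā(·−ē_μ)`.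
[folklore] -/
theorem abs_shiftFit_le (hL : 0 < L) {a : Tor (fine (L ^ n * L ^ K) M) × Fin (d + 1) → ℝ} {r : ℝ} (hr : 0 ≤ r) (μ : Fin (d + 1))
    (h : ∀ z, |fgrad ((L ^ n * L ^ K : ℕ) : ℝ) (bshiftEquiv M (L ^ n * L ^ K) μ) a z| ≤ r) (p : Tor (fine (L ^ n * L ^ K) M) × Fin (d + 1)) :
    |a (p.1 - L ^ n • unitVec (fine (L ^ n * L ^ K) M) μ, p.2) - a (p.1 - unitVec (fine (L ^ n * L ^ K) M) μ, p.2)| ≤ r / ((L ^ K : ℕ) : ℝ) := by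
  have hℓ1 : 1 ≤ L ^ n := Nat.one_le_pow _ _ hL
  have hK0 : (0 : ℝ) < ((L ^ K : ℕ) : ℝ) := by exact_mod_cast pow_pos hL K
  have hN0 : (0 : ℝ) < ((L ^ n * L ^ K : ℕ) : ℝ) := by exact_mod_cast Nat.mul_pos (pow_pos hL n) (pow_pos hL K)
  have h1 := abs_sub_shift_pow_le (L ^ n * L ^ K) M μ h (L ^ n - 1) (p.1 - unitVec (fine (L ^ n * L ^ K) M) μ, p.2)
  have e : (p.1 - unitVec (fine (L ^ n * L ^ K) M) μ) - (L ^ n - 1) • unitVec (fine (L ^ n * L ^ K) M) μ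
      = p.1 - L ^ n • unitVec (fine (L ^ n * L ^ K) M) μ := by
    rw [sub_sub, ← succ_nsmul', Nat.sub_add_cancel hℓ1]
  simp only [e] at h1
  refine h1.trans ?_
  have hcast : (((L ^ n - 1 : ℕ) : ℕ) : ℝ) ≤ ((L ^ n : ℕ) : ℝ) := by exact_mod_cast Nat.sub_le _ _
  calc ((L ^ n - 1 : ℕ) : ℝ) * (r / ((L ^ n * L ^ K : ℕ) : ℝ)) ≤ ((L ^ n : ℕ) : ℝ) * (r / ((L ^ n * L ^ K : ℕ) : ℝ)) :=
        mul_le_mul_of_nonneg_right hcast (div_nonneg hr hN0.le)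
    _ = r / ((L ^ K : ℕ) : ℝ) := by
        have hℓ0 : ((L ^ n : ℕ) : ℝ) ≠ 0 := by exact_mod_cast pow_ne_zero n hL.ne'
        push_cast
        field_simp

end Letters

/-! ## §4 Shift algebra for the remainder (consumed by FILE 70) -/

section Shifts

variable {L} (N : ℕ) [NeZero N] (M : Fin (d + 1) → ℕ) [∀ μ, NeZero (M μ)]

omit L [NeZero N] [∀ μ, NeZero (M μ)] in
/-- A SHIFTED MULTIPLIER IS THE CONJUGATE OF THE MULTIPLIER: `M_{f(·−je_μ)} = ρ(s_μ^{−j})∘M_f∘ρ(s_μ^{j})`. [folklore] -/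
theorem mulOp_shift_eq_conj (f : Tor (fine N M) × Fin (d + 1) → ℝ) (μ : Fin (d + 1)) (j : ℕ) :
    mulOp (fun p : Tor (fine N M) × Fin (d + 1) => f (p.1 - j • unitVec (fine N M) μ, p.2))
      = symbOp M N (sTinv M N μ ^ j) ∘ₗ mulOp f ∘ₗ symbOp M N (sT M N μ ^ j) := by
  refine LinearMap.ext fun g => funext fun p => ?_
  rw [mulOp_apply, LinearMap.comp_apply, LinearMap.comp_apply, sTinv_pow, symbOp_single_apply, one_mul, mulOp_apply, symbOp_sT_pow_apply,
    ← sub_eq_add_neg, sub_add_cancel]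

omit L [∀ μ, NeZero (M μ)] in
/-- `ρ(1 − s_μ^{−j}) = −N⁻¹·ρ(N(s_μ⁻¹ − 1))∘ρ(Σ_{i<j} s_μ^{−i})` — the fine shift commutator is `N⁻¹` times a DIVERGENCE (geometric sum in the symbol algebra).
[folklore] -/
theorem symbOp_one_sub_sTinv_pow (μ : Fin (d + 1)) (j : ℕ) :
    symbOp M N (1 - sTinv M N μ ^ j)
      = -((((N : ℕ) : ℝ))⁻¹ • (symbOp M N (((N : ℕ) : ℝ) • (sTinv M N μ - 1)) * symbOp M N (∑ i ∈ Finset.range j, sTinv M N μ ^ i))) := by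
  have hN : (((N : ℕ) : ℝ)) ≠ 0 := by exact_mod_cast NeZero.ne N
  rw [← map_mul, smul_mul_assoc, map_smul, smul_smul, inv_mul_cancel₀ hN, one_smul, mul_geom_sum, ← map_neg, neg_sub]

variable (L) [NeZero L] (K n : ℕ)

/-- ★ **SHIFTING A PROLONGATION BY `j ≤ L^n` FINE STEPS IS ONE COARSE DIFFERENCE QUOTIENT**: `ρ′(s_μ^{j})∘P = P + M_θ∘P∘ρ̄(N̄(s_μ − 1))` with `0 ≤ θ ≤ N̄⁻¹`
(`P = pull kingPrV`; King's pairing moves by at most one coarse step under `j ≤ L^n` fine steps, dag-n15-a `kingPr_add_smul_unitVec_of_le`). [cite: King1986, p.664 (pairing)] -/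
theorem sT_pow_comp_pull_eq (hM2 : ∀ μ, 2 ≤ fine (L ^ K) M μ) (μ : Fin (d + 1)) {j : ℕ} (hj : j ≤ L ^ n) :
    ∃ θ : Tor (fine (L ^ n * L ^ K) M) × Fin (d + 1) → ℝ, (∀ p, 0 ≤ θ p ∧ θ p ≤ (((L ^ K : ℕ) : ℝ))⁻¹) ∧
      symbOp M (L ^ n * L ^ K) (sT M (L ^ n * L ^ K) μ ^ j) ∘ₗ pull (kingPrV L K n M)
        = pull (kingPrV L K n M) + mulOp θ ∘ₗ pull (kingPrV L K n M) ∘ₗ symbOp M (L ^ K) (sD M (L ^ K) μ ((L ^ K : ℕ) : ℝ)) := by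
  classical
  have hK0 : (0 : ℝ) < ((L ^ K : ℕ) : ℝ) := by exact_mod_cast pow_pos (Nat.pos_of_ne_zero (NeZero.ne L)) K
  refine ⟨fun p => if kingPr L K n M (p.1 + j • unitVec (fine (L ^ n * L ^ K) M) μ) = kingPr L K n M p.1 then 0 else (((L ^ K : ℕ) : ℝ))⁻¹,
    fun p => ?_, ?_⟩
  · by_cases h : kingPr L K n M (p.1 + j • unitVec (fine (L ^ n * L ^ K) M) μ) = kingPr L K n M p.1
    · simp only [h, if_true]; exact ⟨le_rfl, inv_nonneg.mpr hK0.le⟩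
    · simp only [h, if_false]; exact ⟨inv_nonneg.mpr hK0.le, le_rfl⟩
  refine LinearMap.ext fun u => funext fun p => ?_
  simp only [LinearMap.comp_apply, symbOp_sT_pow_apply, pull_apply, LinearMap.add_apply, Pi.add_apply, mulOp_apply, symbOp_sD_apply, kingPrV_eq]
  obtain ⟨δ, hδ, hk⟩ := kingPr_add_smul_unitVec_of_le M L K n p.1 μ hj
  interval_cases δ
  · rw [zero_smul, add_zero] at hk
    simp only [hk, if_true, zero_mul, add_zero]
  · rw [one_smul] at hk
    have hne : kingPr L K n M p.1 + unitVec (fine (L ^ K) M) μ ≠ kingPr L K n M p.1 := add_unitVec_ne M (L ^ K) hM2 _ μ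
    simp only [hk, hne, if_false]
    field_simp
    ring

end Shifts

end Summit.QuantumFields.YangMills.BalabanUVNodes.N15.KingModel.SrcDiv
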